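import Mathlib.NumberTheory.NumberField.Ideal.Basic
import Mathlib.NumberTheory.NumberField.Norm
import Mathlib.RingTheory.DedekindDomain.AdicValuation
import Mathlib.RingTheory.Filtration
import Mathlib.Data.ZMod.Basic
import HarnessLib

/-!
# Rigidity of embeddings at a prime of degree one and ramification index one (proved)

Topic `NumberTheory/GaloisRepresentations`; namespace
`Literature.NumberTheory.GaloisRepresentations`.  A *proofs* file (theorems only; no definition,
no named fact, no instance).

**Theorem** (`NumberField.ringHom_eq_of_map_mem`).  Let `K`, `F` be number fields, `𝔭` a nonzero
prime of `𝓞 K` of absolute norm a prime `p` with `p ∉ 𝔭²` (i.e. residue degree and ramification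
index `1` over `p`), `𝔔 ≠ ⊤` an ideal of `𝓞 F`, and `τ, τ' : K →+* F` two ring homomorphisms
carrying `𝔭` into `𝔔`.  Then `τ = τ'`.

Proof: `𝓞 K / 𝔭ⁿ` has `pⁿ` elements (`N(𝔭ⁿ) = pⁿ`) and characteristic `pⁿ`
(`p^{n-1} ∉ 𝔭ⁿ` as `v_𝔭(p) = 1`), so every element is an integer (`ℤ/pⁿ ↪ 𝓞 K/𝔭ⁿ` is onto) and
ring homomorphisms out of it are unique (`eq_of_forall_exists_intCast`); `τ`, `τ'` induce
homomorphisms `𝓞 K/𝔭ⁿ → 𝓞 F/𝔔ⁿ` (`𝔭ⁿ ↦ 𝔔ⁿ`), hence `τ(a) - τ'(a) ∈ 𝔔ⁿ` for all `a ∈ 𝓞 K` and all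
`n`, so `τ(a) = τ'(a)` by Krull's intersection theorem (`⋂ 𝔔ⁿ = 0`), and `K = Frac 𝓞 K`.

This is the arithmetic input that separates the embeddings `τ : K → F` in the valuation step
(Böckle–Hui's use of Prop. 2.12) of the proof of BH Thm. 1.1 for a general number field: at an
auxiliary prime only one embedding carries `𝔭_v` into a given prime `𝔔` of `F`.
Ref: Neukirch, *Algebraic Number Theory*, Ch. I §8 (primes of degree one); folklore.

## References

* J. Neukirch, *Algebraic Number Theory* (1999), Ch. I §8–§9. [NeukirchANT1999]
* G. Böckle, C.-Y. Hui, Math. Ann. 393 (2025), §2.7, Prop. 2.12. [BockleHui2025]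
-/

noncomputable section

open scoped NumberField
open NumberField IsDedekindDomain

namespace Literature.NumberTheory.GaloisRepresentations

/-! ### Rings in which every element is an integer -/

/-- Ring homomorphisms out of a ring all of whose elements are integers are unique. [folklore] -/
theorem RingHom.eq_of_forall_exists_intCast {R S : Type*} [Ring R] [Ring S]
    (h : ∀ r : R, ∃ k : ℤ, (k : R) = r) (f g : R →+* S) : f = g :=
  RingHom.ext fun r => by
    obtain ⟨k, rfl⟩ := h r
    rw [map_intCast, map_intCast]

/-- **In a finite ring whose cardinality equals its characteristic every element is an integer**
(`ℤ/c ↪ R` is a bijection). [folklore] -/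
theorem forall_exists_intCast_of_card_eq_ringChar {R : Type*} [Ring R] [Finite R]
    (h : Nat.card R = ringChar R) (r : R) : ∃ k : ℤ, (k : R) = r := by
  classical
  haveI : Fintype R := Fintype.ofFinite R
  have hc0 : ringChar R ≠ 0 := by
    rw [← h]
    exact Nat.card_pos.ne'
  haveI : NeZero (ringChar R) := ⟨hc0⟩
  set f : ZMod (ringChar R) →+* R := ZMod.castHom (dvd_refl (ringChar R)) R with hf
  have hinj : Function.Injective f := ZMod.castHom_injective R
  have hcard : Fintype.card (ZMod (ringChar R)) = Fintype.card R := by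
    rw [ZMod.card, ← Nat.card_eq_fintype_card, h]
  have hbij : Function.Bijective f := (Fintype.bijective_iff_injective_and_card f).mpr ⟨hinj, hcard⟩
  obtain ⟨z, rfl⟩ := hbij.2 r
  refine ⟨(z.val : ℤ), ?_⟩
  rw [hf, ZMod.castHom_apply, ZMod.cast_eq_val, Int.cast_natCast]

/-! ### The quotient `𝓞 K / 𝔭ⁿ` at a prime of degree one and ramification index one -/

section DegreeOne

variable {K : Type*} [Field K] [NumberField K]

/-- At a prime `𝔭 ∋ p` with `p ∉ 𝔭²`, `p^{n-1} ∉ 𝔭ⁿ` for `n ≥ 1` (`v_𝔭(p) = 1`). [folklore] -/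
theorem natCast_pow_not_mem_pow (𝔭 : HeightOneSpectrum (𝓞 K)) {p : ℕ}
    (hp : (p : 𝓞 K) ∈ 𝔭.asIdeal) (hp2 : (p : 𝓞 K) ∉ 𝔭.asIdeal ^ 2) {n : ℕ} (hn : 0 < n) :
    (p : 𝓞 K) ^ (n - 1) ∉ 𝔭.asIdeal ^ n := by
  -- `v_𝔭(p) = exp(-1)`
  have h1 : 𝔭.intValuation (p : 𝓞 K) ≤ WithZero.exp (-(1 : ℤ)) := by
    have := (𝔭.intValuation_le_pow_iff_mem (p : 𝓞 K) 1).mpr (by rwa [pow_one])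
    simpa using this
  have h2 : ¬ 𝔭.intValuation (p : 𝓞 K) ≤ WithZero.exp (-(2 : ℤ)) := by
    intro h
    exact hp2 ((𝔭.intValuation_le_pow_iff_mem (p : 𝓞 K) 2).mp (by simpa using h))
  have hv : 𝔭.intValuation (p : 𝓞 K) = WithZero.exp (-(1 : ℤ)) := by
    have hp0 : (p : 𝓞 K) ≠ 0 := fun h0 => by
      rw [h0] at h2
      exact h2 (by simp)
    rw [𝔭.intValuation_if_neg hp0] at h1 h2 ⊢
    rw [WithZero.exp_le_exp] at h1
    rw [WithZero.exp_le_exp, not_le] at h2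
    congr 1
    omega
  intro hmem
  have h3 := (𝔭.intValuation_le_pow_iff_mem ((p : 𝓞 K) ^ (n - 1)) n).mpr hmem
  rw [map_pow, hv, ← WithZero.exp_nsmul, WithZero.exp_le_exp, nsmul_eq_mul] at h3
  omega

/-- **Every element of `𝓞 K / 𝔭ⁿ` is an integer** when `N(𝔭) = p` is prime and `p ∉ 𝔭²`: the
quotient has `pⁿ` elements and characteristic `pⁿ`. [folklore] -/
theorem forall_exists_intCast_quotient_pow (𝔭 : HeightOneSpectrum (𝓞 K)) {p : ℕ} (hp : p.Prime)
    (hN : Ideal.absNorm 𝔭.asIdeal = p) (hp2 : (p : 𝓞 K) ∉ 𝔭.asIdeal ^ 2) (n : ℕ)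
    (r : 𝓞 K ⧸ 𝔭.asIdeal ^ n) : ∃ k : ℤ, (k : 𝓞 K ⧸ 𝔭.asIdeal ^ n) = r := by
  classical
  rcases Nat.eq_zero_or_pos n with rfl | hn
  · -- `𝔭⁰ = ⊤`, the quotient is trivial
    refine ⟨0, ?_⟩
    have : Subsingleton (𝓞 K ⧸ 𝔭.asIdeal ^ 0) := by
      rw [pow_zero, Ideal.one_eq_top]
      exact Ideal.Quotient.subsingleton_iff.mpr rfl
    exact Subsingleton.elim _ _
  have hpmem : (p : 𝓞 K) ∈ 𝔭.asIdeal := by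
    have := Ideal.absNorm_mem 𝔭.asIdeal
    rwa [hN] at this
  have hne : 𝔭.asIdeal ^ n ≠ ⊥ := pow_ne_zero n 𝔭.ne_bot
  haveI : Finite (𝓞 K ⧸ 𝔭.asIdeal ^ n) := Ideal.finiteQuotientOfFreeOfNeBot _ hne
  refine forall_exists_intCast_of_card_eq_ringChar ?_ r
  -- cardinality `pⁿ`
  have hcard : Nat.card (𝓞 K ⧸ 𝔭.asIdeal ^ n) = p ^ n := by
    rw [← Submodule.cardQuot_apply, ← Ideal.absNorm_apply, map_pow, hN]
  -- characteristic `pⁿ`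
  set c := ringChar (𝓞 K ⧸ 𝔭.asIdeal ^ n) with hc
  have hc0 : ((p ^ n : ℕ) : 𝓞 K ⧸ 𝔭.asIdeal ^ n) = 0 := by
    rw [← map_natCast (Ideal.Quotient.mk (𝔭.asIdeal ^ n)), Ideal.Quotient.eq_zero_iff_mem,
      Nat.cast_pow]
    exact Ideal.pow_mem_pow hpmem n
  have hcdvd : c ∣ p ^ n := (ringChar.spec _ _).mp hc0
  obtain ⟨j, hj, hcj⟩ := (Nat.dvd_prime_pow hp).mp hcdvd
  have hjn : j = n := by
    by_contra hne'
    have hjlt : j < n := lt_of_le_of_ne hj hne'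
    -- then `p^j = 0` in the quotient, i.e. `p^j ∈ 𝔭ⁿ`, so `p^{n-1} ∈ 𝔭ⁿ`
    have h0 : ((p ^ j : ℕ) : 𝓞 K ⧸ 𝔭.asIdeal ^ n) = 0 := by
      rw [← hcj, hc]
      exact ringChar.Nat.cast_ringChar
    rw [← map_natCast (Ideal.Quotient.mk (𝔭.asIdeal ^ n)), Ideal.Quotient.eq_zero_iff_mem,
      Nat.cast_pow] at h0
    have hmem : (p : 𝓞 K) ^ (n - 1) ∈ 𝔭.asIdeal ^ n := by
      have e : (p : 𝓞 K) ^ (n - 1) = (p : 𝓞 K) ^ j * (p : 𝓞 K) ^ (n - 1 - j) := by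
        rw [← pow_add]
        congr 1
        omega
      rw [e]
      exact Ideal.mul_mem_right _ _ h0
    exact natCast_pow_not_mem_pow 𝔭 hpmem hp2 hn hmem
  rw [hcard, hcj, hjn]

/-! ### The rigidity theorem -/

/-- **Rigidity of embeddings at a prime of degree one and ramification index one.**  Let `K, F`
be number fields, `𝔭` a nonzero prime of `𝓞 K` with `N(𝔭) = p` prime and `p ∉ 𝔭²`, `𝔔 ≠ ⊤` an
ideal of `𝓞 F`, and `τ, τ' : K →+* F` ring homomorphisms with `τ(𝔭) ⊆ 𝔔` and `τ'(𝔭) ⊆ 𝔔`.  Then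
`τ = τ'`. [folklore] -/
theorem NumberField.ringHom_eq_of_map_mem {F : Type*} [Field F] [NumberField F]
    (𝔭 : HeightOneSpectrum (𝓞 K)) {p : ℕ} (hp : p.Prime) (hN : Ideal.absNorm 𝔭.asIdeal = p)
    (hp2 : (p : 𝓞 K) ∉ 𝔭.asIdeal ^ 2) {𝔔 : Ideal (𝓞 F)} (h𝔔 : 𝔔 ≠ ⊤) (τ τ' : K →+* F)
    (hτ : ∀ a ∈ 𝔭.asIdeal, RingOfIntegers.mapRingHom τ a ∈ 𝔔)
    (hτ' : ∀ a ∈ 𝔭.asIdeal, RingOfIntegers.mapRingHom τ' a ∈ 𝔔) : τ = τ' := by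
  classical
  set T : 𝓞 K →+* 𝓞 F := RingOfIntegers.mapRingHom τ with hT
  set T' : 𝓞 K →+* 𝓞 F := RingOfIntegers.mapRingHom τ' with hT'
  -- `S(𝔭ⁿ) ⊆ 𝔔ⁿ`
  have hpow : ∀ (S : 𝓞 K →+* 𝓞 F), (∀ a ∈ 𝔭.asIdeal, S a ∈ 𝔔) → ∀ n : ℕ,
      ∀ a ∈ 𝔭.asIdeal ^ n, S a ∈ 𝔔 ^ n := by
    intro S hS n a ha
    have h1 : (𝔭.asIdeal ^ n).map S ≤ 𝔔 ^ n := by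
      rw [Ideal.map_pow]
      exact Ideal.pow_right_mono (Ideal.map_le_iff_le_comap.mpr fun x hx => hS x hx) n
    exact h1 (Ideal.mem_map_of_mem S ha)
  have key : ∀ n : ℕ, ∀ a : 𝓞 K, T a - T' a ∈ 𝔔 ^ n := by
    intro n a
    -- the induced maps `𝓞 K / 𝔭ⁿ → 𝓞 F / 𝔔ⁿ` coincide
    set φ : 𝓞 K ⧸ 𝔭.asIdeal ^ n →+* 𝓞 F ⧸ 𝔔 ^ n :=
      Ideal.Quotient.lift (𝔭.asIdeal ^ n) ((Ideal.Quotient.mk (𝔔 ^ n)).comp T)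
        fun a ha => by
          rw [RingHom.comp_apply, Ideal.Quotient.eq_zero_iff_mem]
          exact hpow T hτ n a ha with hφ
    set φ' : 𝓞 K ⧸ 𝔭.asIdeal ^ n →+* 𝓞 F ⧸ 𝔔 ^ n :=
      Ideal.Quotient.lift (𝔭.asIdeal ^ n) ((Ideal.Quotient.mk (𝔔 ^ n)).comp T')
        fun a ha => by
          rw [RingHom.comp_apply, Ideal.Quotient.eq_zero_iff_mem]
          exact hpow T' hτ' n a ha with hφ'
    have heq : φ = φ' :=
      RingHom.eq_of_forall_exists_intCast (forall_exists_intCast_quotient_pow 𝔭 hp hN hp2 n) φ φ'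
    have h1 : φ (Ideal.Quotient.mk _ a) = φ' (Ideal.Quotient.mk _ a) := by rw [heq]
    rw [hφ, hφ', Ideal.Quotient.lift_mk, Ideal.Quotient.lift_mk, RingHom.comp_apply,
      RingHom.comp_apply, Ideal.Quotient.eq] at h1
    exact h1
  -- Krull: `⋂ 𝔔ⁿ = 0`
  have hT_eq : ∀ a : 𝓞 K, T a = T' a := by
    intro a
    have hmem : T a - T' a ∈ ⨅ n : ℕ, 𝔔 ^ n := Ideal.mem_iInf.mpr fun n => key n a
    rw [Ideal.iInf_pow_eq_bot_of_isDomain 𝔔 h𝔔, Ideal.mem_bot, sub_eq_zero] at hmem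
    exact hmem
  -- pass to the fraction field
  have hK : ∀ a : 𝓞 K, τ (a : K) = τ' (a : K) := fun a => by
    have := congrArg (fun x : 𝓞 F => (x : F)) (hT_eq a)
    simpa [hT, hT'] using this
  refine RingHom.ext fun k => ?_
  obtain ⟨a, b, hb, rfl⟩ := IsFractionRing.div_surjective (A := 𝓞 K) k
  rw [map_div₀, map_div₀]
  change τ (a : K) / τ (b : K) = τ' (a : K) / τ' (b : K)
  rw [hK a, hK b]

end DegreeOne

end Literature.NumberTheory.GaloisRepresentations
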